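import Literature.MathematicalPhysics.QuantumFieldTheory.Balaban1983to89.B15Prop1CarrierStdB
import Literature.MathematicalPhysics.QuantumFieldTheory.Balaban1983to89.B15Eq177GaugeInvarianceB

/-!
# `Balaban1983to89.B15DeterminingSetsBAtDatum` — [Balaban1988Convergent] (= [III]) (2.12)–(2.13) pp. 256–257 ∕ [Balaban1984PropagatorsII] (= [II]) (2.3) p. 224 ∕
# [Balaban1989LargeFieldI] (= [B15]) (1.74), (1.77), Prop. 1, (1.79) pp. 192–195: THE SITE-LEVEL CARRIER OF A BOND-LEVEL SOLUTION MAP **READ AT ONE BOND DATUM**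
# (`DetBackgroundB.atDatum`, the PUSH-FORWARD companion of F0a's pull-back `DetBackgroundB.toDetBackground`), AND THE `rfl` DICTIONARY: every [B15] §1 object of the
# (b)-keyed Literature that reads its background `bg : DetBackground` only through the solution map `bg.U` IS, at `bg := bgB.atDatum 𝔅`, the corresponding `…B` object of
# `B15DeterminingSetsBBackgrounds ∕ B15Sect1InstancesB ∕ B15Prop1CarrierStdB ∕ B15Eq177GaugeInvarianceB` at the bond datum `𝔅`

statement-level skeleton of published theorems with citation tags; proofs where landed; nothing here is a claim about the
Yang–Mills mass gap

Cell `pub-ymgap` (HUMAN RULINGS D-0062 ∕ D-0149), lane `pub-ymgap-dag-n12-c` g35 (R134 seat (a), N12 = [B15], s1 — the lane of [B15] Proposition 1; `--kind definition --supports`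
K1⁹ `stmt-QuantumFields-27364`; count-neutral).  (E1) variant (iii-b), the lane's memo `N12-REATTACHMENT-DESIGN-2026-08-30.md` §3 design D2 «abstraction», made a TOOL: the
re-attachment of N12's Proposition-1 road to print's [II] (2.3) datum (dag-n12-d's census I.32897 (3), I.18130) needs, for every (b)-keyed theorem `T (bg : DetBackground …)`
whose statement reads `bg` only through `bg.U` (via `bgKZ ∕ fun177 ∕ IsVLambda ∕ bgU0 ∕ bgKZstd ∕ chi175std ∕ fun177std ∕ IsVLambdaStd ∕ bgU0std ∕ Inst.std ∕ InstOn.std ∕ Cov181 ∕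
ukBox`), NO twin at all: `T (bgB.atDatum 𝔅)` IS the print-datum statement, by the `rfl` lemmas of §2–§4 (e.g. `B15Prop1AnalyticExtNearRadius.prop1Printed_lfVarOn_std_of_An`,
`B15Prop1JointHolomorphyFromBackground.jointHolomorphic_fun177std_of_valueMatched`, the carrier lemmas of `B15Prop1Carrier`).  Only theorems that read `bg.dom ∕ bg.isMinimizer`, the
concrete solution maps of record (`Node00.bgOfRecord ∕ bgMSCoPOfRecord`), or a site-level fibre `IsMinimizer … 𝔹 ∕ AgreeOn 𝔹` keep needing a bond-datum edition.

HONESTY GUARD (director-ym №338 (5)).  PURELY ADDITIVE: two new `def`s (`DetBackgroundB.along`, `DetBackgroundB.atDatum`) and `rfl ∕ Iff.rfl` lemmas; NOTHING in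
`B15DeterminingSets(B)`, `B15Sect1Instances(B)`, `B15Prop1Carrier(StdB)`, `B15Eq177GaugeInvariance(B)`, `B14.Eq216Concrete` is edited; no displayed premise of any consumer is
deleted or weakened.  The push-forward's domain field is the TRUTHFUL one (`V ∈ dom 𝔹 ↔ bondsDet 𝔹 = Φ 𝔹 ∧ V ∈ bgB.dom (Φ 𝔹)`): the site-level minimiser property
`DetBackground.isMinimizer` is claimed exactly where the site-level datum's bonds ARE the bond datum read (then it is F0a's `isMinimizer_iff_isMinimizerB`); in particular at print's
datum `lamBondsSeq Ω k`, which is NOT of the form `bondsDet 𝔹` in general, the carrier asserts no site-level minimiser property (and none is used by the value-level theorems it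
serves).  Nothing of Bałaban's analysis is asserted; K0⁷ ∕ K1⁹ NOT closed; N12 NOT discharged; one finite 𝕋⁴ programme at fixed ε — nothing continuum ∕ ℝ⁴ ∕ OS; the Yang–Mills
mass gap (Clay) is NOT proved by any of this.  No `instance`, no `notation`.

WHAT IS HERE.
* §1 `DetBackgroundB.along Φ` (push-forward along a re-indexing `Φ : DetSet P → BDetSet P`; F0a's pull-back is `Φ := bondsDet` on the solution map) · `DetBackgroundB.atDatum 𝔅`
  (`Φ := fun _ => 𝔅`) · the `rfl` API (`…_reg ∕ …_U ∕ mem_dom_…_iff`, `atDatum_eq_along`, `toDetBackground_U_eq_along_bondsDet`).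
* §2 [B15] §1 ∕ [III] (2.16) ∕ [15] (181) at the carrier: `bgKZ_atDatum ∕ fun177_atDatum ∕ isVLambda_atDatum_iff ∕ bgU0_atDatum ∕ ukBox_atDatum ∕ cov181_atDatum_iff` (all `rfl`).
* §3 print's instances (`B15Sect1Instances`) at the carrier: `bgKZstd_atDatum ∕ chi175std_atDatum_iff ∕ fun177std_atDatum ∕ isVLambdaStd_atDatum_iff ∕ bgU0std_atDatum` at the family
  value `bd k (maxDomT M₁ Z)`, and the datum-general forms `bgKZstd_atDatum_eq_bgKZB ∕ fun177std_atDatum_eq_fun177B` (the carrier ignores the site-level argument `Bj M₁ Z k`).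
* §4 the carrier of Proposition 1 (`B15Prop1Carrier`): `Inst.std_atDatum ∕ InstOn.std_atDatum` (`rfl`).

References: [III] = [Balaban1988Convergent] (2.10)–(2.13) pp.256–257, (2.16) p.257; [II] = [Balaban1984PropagatorsII] (2.3) p.224; [B15] = [Balaban1989LargeFieldI] (1.74) p.192,
(1.75) p.193, (1.77)–(1.78) Prop. 1 p.194, (1.79) p.195; [15] = [Balaban1985Variational] (181) p.307; [I] = [Balaban1987RG1] (0.1) p.251.
-/

open Set

namespace Literature.MathematicalPhysics.QuantumFieldTheory.Balaban1983to89.B15DeterminingSetsB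

open Literature.MathematicalPhysics.QuantumFieldTheory.Balaban1983to89
open B15DeterminingSets B14.Eq213DetSet B14.Eq216Concrete GaugeField
open Literature.MathematicalPhysics.QuantumFieldTheory.BalabanImbrieJaffe1984to88.BIJ85Eq453GaugeField

variable {P : Params}

/-! ## §1  The push-forward of a bond-level solution map to the site-level carrier -/

section PushForward

variable {G : Type*} [GaugeGroup G] {av : ∀ j, Averaging P j G}

/-- **PUSH-FORWARD OF A BOND-LEVEL (2.12) SOLUTION MAP ALONG A RE-INDEXING** `Φ : DetSet P → BDetSet P`: the site-level carrier `B15DeterminingSets.DetBackground` whose solution map at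
a site-level datum `𝔹` is the bond-level map `bg.U` READ AT `Φ 𝔹` — verbatim [III] p. 256 *"(2.12) … U_𝐁(V)"*, p. 257 *"U(𝐁_j(Ω), ·) = U_{j,Ω}(·) (2.13)"*, with the constrained
bonds `Φ 𝔹` ([I] p. 251 *"bonds which intersect Γ_j"* = `bondsDet`, F0a's pull-back `toDetBackground`; [II] (2.3) p. 224 = `lamBondsSeq`).  The domain is the TRUTHFUL one: the
site-level minimiser property is recorded exactly at the data `𝔹` whose bonds ARE the bonds read, `bondsDet 𝔹 = Φ 𝔹` (F0a `isMinimizer_iff_isMinimizerB`); the regular class is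
`bg.reg`.  Nothing asserted. [cite: Balaban1988Convergent, (2.12)–(2.13) p.256–257; Balaban1984PropagatorsII, (2.3) p.224; Balaban1987RG1, (0.1) p.251] -/
def DetBackgroundB.along (bg : DetBackgroundB P G av) (Φ : DetSet P → BDetSet P) : DetBackground P G av where
  reg := bg.reg
  dom := fun 𝔹 => {V | bondsDet 𝔹 = Φ 𝔹 ∧ V ∈ bg.dom (Φ 𝔹)}
  U := fun 𝔹 V => bg.U (Φ 𝔹) V
  isMinimizer := fun 𝔹 V hV =>
    (isMinimizer_iff_isMinimizerB av bg.reg 𝔹 V (bg.U (Φ 𝔹) V)).2 (hV.1 ▸ bg.isMinimizer (Φ 𝔹) V hV.2)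

/-- **THE SITE-LEVEL CARRIER OF A BOND-LEVEL SOLUTION MAP READ AT ONE BOND DATUM** `𝔅` (`along` the constant re-indexing): its solution map is `(𝔹, V) ↦ bg.U 𝔅 V` for EVERY
site-level datum `𝔹` — so every [B15] §1 object formed from it ((1.74) `bgKZ`, (1.77) `fun177`, …, the carrier `Inst.std`) IS the bond-datum object at `𝔅` (§2–§4, `rfl`).  At
print's [II] (2.3) datum one takes `𝔅 := lamBondsSeq (maxDomT M₁ Z) k` (= `B15Sect1Instances.lamDatumP k (maxDomT M₁ Z)`).  Nothing asserted.
[cite: Balaban1988Convergent, (2.12)–(2.13) p.256–257; Balaban1984PropagatorsII, (2.3) p.224] -/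
def DetBackgroundB.atDatum (bg : DetBackgroundB P G av) (𝔅 : BDetSet P) : DetBackground P G av where
  reg := bg.reg
  dom := fun 𝔹 => {V | bondsDet 𝔹 = 𝔅 ∧ V ∈ bg.dom 𝔅}
  U := fun _ V => bg.U 𝔅 V
  isMinimizer := fun 𝔹 V hV =>
    (isMinimizer_iff_isMinimizerB av bg.reg 𝔹 V (bg.U 𝔅 V)).2 (hV.1 ▸ bg.isMinimizer 𝔅 V hV.2)

variable (bg : DetBackgroundB P G av)

/-- `atDatum` is `along` the constant re-indexing (definitional). [cite: Balaban1988Convergent, (2.12)–(2.13) p.256–257 (bookkeeping)] -/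
theorem DetBackgroundB.atDatum_eq_along (𝔅 : BDetSet P) : bg.atDatum 𝔅 = bg.along (fun _ => 𝔅) := rfl

/-- The push-forward keeps the regular class. [cite: Balaban1988Convergent, (2.12) p.256 (bookkeeping)] -/
theorem DetBackgroundB.along_reg (Φ : DetSet P → BDetSet P) : (bg.along Φ).reg = bg.reg := rfl

/-- The push-forward's solution map is the bond-level map read at `Φ 𝔹`. [cite: Balaban1988Convergent, (2.12)–(2.13) p.256–257 (bookkeeping)] -/
theorem DetBackgroundB.along_U (Φ : DetSet P → BDetSet P) (𝔹 : DetSet P) (V : MSField P G) : (bg.along Φ).U 𝔹 V = bg.U (Φ 𝔹) V := rfl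

/-- The push-forward's (truthful) domain. [cite: Balaban1988Convergent, (2.12)–(2.13) p.256–257 (bookkeeping)] -/
theorem DetBackgroundB.mem_dom_along_iff (Φ : DetSet P → BDetSet P) (𝔹 : DetSet P) (V : MSField P G) :
    V ∈ (bg.along Φ).dom 𝔹 ↔ bondsDet 𝔹 = Φ 𝔹 ∧ V ∈ bg.dom (Φ 𝔹) := Iff.rfl

/-- The carrier at one datum keeps the regular class. [cite: Balaban1988Convergent, (2.12) p.256 (bookkeeping)] -/
theorem DetBackgroundB.atDatum_reg (𝔅 : BDetSet P) : (bg.atDatum 𝔅).reg = bg.reg := rfl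

/-- **The carrier's solution map at ANY site-level datum is the bond-level map at `𝔅`.** [cite: Balaban1988Convergent, (2.12)–(2.13) p.256–257 (bookkeeping)] -/
theorem DetBackgroundB.atDatum_U (𝔅 : BDetSet P) (𝔹 : DetSet P) (V : MSField P G) : (bg.atDatum 𝔅).U 𝔹 V = bg.U 𝔅 V := rfl

/-- The carrier's (truthful) domain. [cite: Balaban1988Convergent, (2.12)–(2.13) p.256–257 (bookkeeping)] -/
theorem DetBackgroundB.mem_dom_atDatum_iff (𝔅 : BDetSet P) (𝔹 : DetSet P) (V : MSField P G) :
    V ∈ (bg.atDatum 𝔅).dom 𝔹 ↔ bondsDet 𝔹 = 𝔅 ∧ V ∈ bg.dom 𝔅 := Iff.rfl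

/-- F0a's pull-back and the push-forward along `bondsDet` have the same solution map (their domains agree up to the trivial conjunct). [cite: Balaban1987RG1, (0.1) p.251; Balaban1988Convergent, (2.13) p.257 (bookkeeping)] -/
theorem DetBackgroundB.toDetBackground_U_eq_along_bondsDet (𝔹 : DetSet P) (V : MSField P G) :
    bg.toDetBackground.U 𝔹 V = (bg.along bondsDet).U 𝔹 V := rfl

/-- The pull-back's solution map at `𝔹` is the carrier's at the (b)-datum `bondsDet 𝔹`, read at any site-level argument. [cite: Balaban1987RG1, (0.1) p.251 (bookkeeping)] -/
theorem DetBackgroundB.toDetBackground_U_eq_atDatum (𝔹 𝔹' : DetSet P) (V : MSField P G) :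
    bg.toDetBackground.U 𝔹 V = (bg.atDatum (bondsDet 𝔹)).U 𝔹' V := rfl

end PushForward

/-! ## §2  [B15] §1 ∕ [III] (2.16) ∕ [15] (181): the (b)-keyed objects AT THE CARRIER are the bond-datum objects (`rfl`) -/

section LocalBackgroundsAtDatum

variable {G : Type*} [GaugeGroup G] {av : ∀ j, Averaging P j G} (bg : DetBackgroundB P G av) (𝔅 : BDetSet P) {k : ℕ}

/-- **(1.74) at the carrier IS (1.74) over `(bg, 𝔅)`**: `bgKZ (bg.atDatum 𝔅) 𝔹 Qs = bgKZB bg 𝔅 Qs` for EVERY site-level argument `𝔹` — `rfl`. [cite: Balaban1989LargeFieldI, (1.74) p.192; Balaban1984PropagatorsII, (2.3) p.224] -/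
theorem bgKZ_atDatum (BkZ : DetSet P) (Qs : GaugeField P k G → GaugeField P 0 G) : bgKZ (bg.atDatum 𝔅) BkZ Qs = bgKZB bg 𝔅 Qs := rfl

/-- **(1.77) at the carrier IS (1.77) over `(bg, 𝔅)`** — `rfl`. [cite: Balaban1989LargeFieldI, (1.77) p.194; Balaban1984PropagatorsII, (2.3) p.224] -/
theorem fun177_atDatum (BkZ : DetSet P) (Qs : GaugeField P k G → GaugeField P 0 G) : fun177 (bg.atDatum 𝔅) BkZ Qs = fun177B bg 𝔅 Qs := rfl

/-- Prop. 1's minimiser predicate at the carrier IS `IsVLambdaB` over `(bg, 𝔅)` — `Iff.rfl`. [cite: Balaban1989LargeFieldI, Prop. 1 (1.78) p.194; Balaban1984PropagatorsII, (2.3) p.224] -/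
theorem isVLambda_atDatum_iff (BkZ : DetSet P) (Qs : GaugeField P k G → GaugeField P 0 G) (Λb : Set (PBond P k)) (Vout VΛ : GaugeField P k G) :
    IsVLambda (bg.atDatum 𝔅) BkZ Qs Λb Vout VΛ ↔ IsVLambdaB bg 𝔅 Qs Λb Vout VΛ := Iff.rfl

/-- (1.79) at the carrier IS `bgU0B` over `(bg, 𝔅)` — `rfl`. [cite: Balaban1989LargeFieldI, (1.79) p.195; Balaban1984PropagatorsII, (2.3) p.224] -/
theorem bgU0_atDatum (BkZ : DetSet P) (Qs : GaugeField P k G → GaugeField P 0 G) : bgU0 (bg.atDatum 𝔅) BkZ Qs = bgU0B bg 𝔅 Qs := rfl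

/-- [III] (2.16) `u_k` at the carrier: r11's `ukBox (bg.atDatum 𝔅) M₁ □ k` is (1.74) over `(bg, 𝔅)` with `Q_k^{s*} := qsstarGIter0 k`, for every `□` — `rfl`. [cite: Balaban1988Convergent, (2.16) p.257; Balaban1984PropagatorsII, (2.3) p.224] -/
theorem ukBox_atDatum (M₁ : ℕ) (box4 : Set (Site P 0)) (k : ℕ) : ukBox (bg.atDatum 𝔅) M₁ box4 k = bgKZB bg 𝔅 (qsstarGIter0 k) := rfl

/-- [15] (181)'s configuration-level letter at the carrier IS `Cov181B` over `(bg, 𝔅)` — `Iff.rfl`. [cite: Balaban1985Variational, (181) p.307; Balaban1984PropagatorsII, (2.3) p.224] -/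
theorem cov181_atDatum_iff (𝔹 : DetSet P) (ubar : GaugeTransf P 0 G) :
    B15Eq177GaugeInvariance.Cov181 (bg.atDatum 𝔅) 𝔹 ubar ↔ B15Eq177GaugeInvariance.Cov181B bg 𝔅 ubar := Iff.rfl

end LocalBackgroundsAtDatum

/-! ## §3  Print's instances (`B15Sect1Instances`) AT THE CARRIER are the bond-datum-family instances (`rfl`) -/

section InstancesAtDatum

open B15Sect1Instances

variable {G : Type*} [GaugeGroup G] {av : ∀ j, Averaging P j G} (bg : DetBackgroundB P G av) (M₁ : ℕ)
  (bd : ℕ → (ℕ → Set (Site P 0)) → BDetSet P) (Z Λ : Set (Site P 0)) (k : ℕ)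

/-- **(1.74) `U_{k,Z}` at the carrier read at the family value `bd k (maxDomT M₁ Z)` IS `bgKZstdB bg M₁ bd Z k`** — `rfl`. [cite: Balaban1989LargeFieldI, (1.74) p.192; Balaban1984PropagatorsII, (2.3) p.224] -/
theorem bgKZstd_atDatum : bgKZstd (bg.atDatum (bd k (maxDomT M₁ Z))) M₁ Z k = bgKZstdB bg M₁ bd Z k := rfl

/-- (1.74) at the carrier for an ARBITRARY bond datum: `bgKZstd (bg.atDatum 𝔅) M₁ Z k = bgKZB bg 𝔅 Q_k^{s*}` (the carrier ignores the site-level argument `𝐁_k(Z)`). [cite: Balaban1989LargeFieldI, (1.74) p.192 (bookkeeping)] -/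
theorem bgKZstd_atDatum_eq_bgKZB (𝔅 : BDetSet P) : bgKZstd (bg.atDatum 𝔅) M₁ Z k = bgKZB bg 𝔅 (qsstarGIter0 k) := rfl

/-- (1.75) at the carrier IS `chi175stdB` at the family — `Iff.rfl`. [cite: Balaban1989LargeFieldI, (1.75) p.193; Balaban1984PropagatorsII, (2.3) p.224] -/
theorem chi175std_atDatum_iff (Ω : ℕ → Set (Site P 0)) (εk η : ℝ) (Vk : GaugeField P k G) :
    chi175std (bg.atDatum (bd k (maxDomT M₁ Z))) M₁ Z Λ k Ω εk η Vk ↔ chi175stdB bg M₁ bd Z Λ k Ω εk η Vk := Iff.rfl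

/-- **(1.77) `V_k ↦ A(U_{k,Z}(V_k))` at the carrier IS `fun177stdB bg M₁ bd Z k`** — `rfl`. [cite: Balaban1989LargeFieldI, (1.77) p.194; Balaban1984PropagatorsII, (2.3) p.224] -/
theorem fun177std_atDatum : fun177std (bg.atDatum (bd k (maxDomT M₁ Z))) M₁ Z k = fun177stdB bg M₁ bd Z k := rfl

/-- (1.77) at the carrier for an arbitrary bond datum: `fun177std (bg.atDatum 𝔅) M₁ Z k = fun177B bg 𝔅 Q_k^{s*}`. [cite: Balaban1989LargeFieldI, (1.77) p.194 (bookkeeping)] -/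
theorem fun177std_atDatum_eq_fun177B (𝔅 : BDetSet P) : fun177std (bg.atDatum 𝔅) M₁ Z k = fun177B bg 𝔅 (qsstarGIter0 k) := rfl

/-- Prop. 1's minimiser at the carrier IS `IsVLambdaStdB` at the family — `Iff.rfl`. [cite: Balaban1989LargeFieldI, Prop. 1 (1.78) p.194; Balaban1984PropagatorsII, (2.3) p.224] -/
theorem isVLambdaStd_atDatum_iff (Vout VΛ : GaugeField P k G) :
    IsVLambdaStd (bg.atDatum (bd k (maxDomT M₁ Z))) M₁ Z Λ k Vout VΛ ↔ IsVLambdaStdB bg M₁ bd Z Λ k Vout VΛ := Iff.rfl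

/-- (1.79) at the carrier IS `bgU0stdB` at the family — `rfl`. [cite: Balaban1989LargeFieldI, (1.79) p.195; Balaban1984PropagatorsII, (2.3) p.224] -/
theorem bgU0std_atDatum : bgU0std (bg.atDatum (bd k (maxDomT M₁ Z))) M₁ Z k = bgU0stdB bg M₁ bd Z k := rfl

/-- The (b)-instance of record through the carrier: `fun177std bg.toDetBackground M₁ Z k = fun177std (bg.atDatum (genSetDatumP k (maxDomT M₁ Z))) M₁ Z k` (both are `fun177stdB bg M₁
genSetDatumP Z k`). [cite: Balaban1989LargeFieldI, (1.77) p.194; Balaban1987RG1, (0.1) p.251 (bookkeeping)] -/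
theorem fun177std_toDetBackground_eq_atDatum :
    fun177std bg.toDetBackground M₁ Z k = fun177std (bg.atDatum (genSetDatumP k (maxDomT M₁ Z))) M₁ Z k := rfl

end InstancesAtDatum

/-! ## §4  The carrier of Proposition 1 (`B15Prop1Carrier`) AT THE CARRIER is `Inst.stdB ∕ InstOn.stdB` (`rfl`) -/

section CarrierAtDatum

open B15Sect1Instances B15Prop1Carrier

variable {G : Type} [GaugeGroup G] {av : ∀ j, Averaging P j G} (bg : DetBackgroundB P G av) (M₁ : ℕ)
  (bd : ℕ → (ℕ → Set (Site P 0)) → BDetSet P) (Z Λ : Set (Site P 0)) (k : ℕ)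

/-- **PRINT'S INSTANCE OF PROPOSITION 1's DATA at the carrier IS `Inst.stdB bg M₁ bd …`** — `rfl`; hence every `B15Prop1Carrier` ∕ `B15.Prop1Printed (lfVarOn …)` theorem stated for
instances `Inst.std (bg i) …` over site-level backgrounds holds VERBATIM for the bond-datum instances (take `bg i := (bgB i).atDatum (bd (k i) (maxDomT M₁ (Z i)))`).
[cite: Balaban1989LargeFieldI, Prop. 1 (1.77)–(1.78) p.194; Balaban1984PropagatorsII, (2.3) p.224] -/
theorem Inst.std_atDatum (M : ℝ) (An : ℝ → GaugeField P k G → Prop) :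
    Inst.std (bg.atDatum (bd k (maxDomT M₁ Z))) M₁ Z Λ k M An = Inst.stdB bg M₁ bd Z Λ k M An := rfl

/-- Print's instance WITH ITS EXAMPLE DOMAIN at the carrier IS `InstOn.stdB bg M₁ bd …` — `rfl`. [cite: Balaban1989LargeFieldI, (1.77) p.194; Balaban1984PropagatorsII, (2.3) p.224] -/
theorem InstOn.std_atDatum (M a₁ : ℝ) (An : ℝ → GaugeField P k G → Prop) :
    InstOn.std (bg.atDatum (bd k (maxDomT M₁ Z))) M₁ Z Λ k M a₁ An = InstOn.stdB bg M₁ bd Z Λ k M a₁ An := rfl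

/-- The instance at the carrier for an arbitrary bond datum, componentwise: its function is `fun177B bg 𝔅 Q_k^{s*}`. [cite: Balaban1989LargeFieldI, (1.77) p.194 (bookkeeping)] -/
theorem Inst.std_atDatum_f (𝔅 : BDetSet P) (M : ℝ) (An : ℝ → GaugeField P k G → Prop) :
    (Inst.std (bg.atDatum 𝔅) M₁ Z Λ k M An).f = fun177B bg 𝔅 (qsstarGIter0 k) := rfl

end CarrierAtDatum

end Literature.MathematicalPhysics.QuantumFieldTheory.Balaban1983to89.B15DeterminingSetsB
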